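import Literature.MathematicalPhysics.QuantumFieldTheory.Dimock2011to13.SmallFieldStepAssembly

/-!
# Dimock, *The renormalization group according to Balaban* I, §3.5 "normalization": the extraction `𝓡` of the
# relevant parts (renorm), *"it is straightforward to check that 𝓡E is normalized for small polymers"*, the base-point
# independence of `α_{2,μ}`, and the resummation (renorm2) `E = −ε(E)Vol(𝕋) − ½μ(E)‖φ‖² + 𝓡E` with its two symmetry
# facts (□-independence by lattice symmetry, `Σ_{X⊃□}α_{2,μ}(E,X) = 0` by reflection) — PROVED; LEMMA 13 (`study`)'s
# mechanism from (summing)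

**Citation header (reproduction of PUBLISHED work; template of the Bałaban lattice Yang–Mills cell).**
J. Dimock, *The renormalization group according to Balaban I. Small fields*, Rev. Math. Phys. **25** (2013) 1330010
(= arXiv:1108.1335v2) [Dimock2013], §3.5 "normalization" TeX L1499–1838: the definition (normalization) L1517–1533, small
polymers L1535–1538, `𝒦_k^{norm}` L1540–1545, the operator `𝓡` = eq. (renorm) L1730–1751 with the coefficients
`α₀, α₂, α_{2,μ}` L1743–1750, LEMMA `\label{rlem}` (#12) L1759–1799, the resummation (renorm2) L1802–1821, LEMMA
`\label{study}` (#13) L1824–1836; §3.3 (summing) L1356–1361 and condition (d.) of the definition of `𝒦_k` L1305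
(*"E(X, φ) is invariant under lattice symmetries (translations, rotations by π/2, reflections)"*).  TeX line numbers
refer to the arXiv source held by the cell (`inputs/files/dimock/src/1108.1335/1108.1335.tex`); every quotation below
was read there this session.  Dimock's papers are published and refereed and are the cell's TEMPLATE, not
manuscripts under audit; no quantity of the Bałaban series is touched.  Dimock on provenance (L1505): *"The following
treatment roughly follows [BDH98]."*

**What the paper prints (verbatim).**  L1517–1533: *"The functional E ∈ 𝒦_k is said to be normalized if E(X,0) = 0,
E_2(X, 0; 1,1) = 0, E_2(X, 0; 1,x_μ) = 0  Here the derivatives can be evaluated by E_n(X, φ; f_1, …, f_n) = ∂ⁿ/∂t_1⋯∂t_n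
E_n(X, φ + t_1f_1 + ⋯ + t_nf_n)|_{t_i=0}"* (footnote: *"1 means the function x → 1 and x_μ means the projection x →
x_μ"*).  L1730–1751: *"Given E ∈ 𝒦_k we define 𝓡E ∈ 𝒦_k as follows. If X is small (X ∈ 𝒮) then 𝓡E(X) is defined by
E(X, φ) = α_0(E,X)Vol(X) + α_2(E,X)∫_X φ² + Σ_μ α_{2,μ}(E,X)∫_X φ ∂_μφ + 𝓡E(X, φ) where α_0(E,X) = (1/Vol(X))E(X,0),
α_2(E,X) = (1/(2Vol(X)))E_2(X, 0; 1,1), α_{2,μ}(E,X) = (1/Vol(X))(E_2(X, 0; 1, x_μ − x⁰_μ) − (1/Vol(X))E_2(X, 0; 1,1)∫_X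
(x_μ − x⁰_μ))  The last is independent of the base point x⁰, which we take to be in X. Then it is straightforward to
check that 𝓡E is normalized for small polymers. If X is large then 𝓡E(X) = E(X)."*  L1802–1821: *"Inserting (renorm)
into E = Σ_X E(X) and defining 𝓡E = Σ_X 𝓡E(X) we find we have extracted energy and mass terms: E = −ε(E)Vol(𝕋_{M+N−k})
− ½μ(E)‖φ‖² + 𝓡E  Here ε(E) = −Σ_{X⊃□, X∈𝒮} α_0(E,X), ½μ(E) = −Σ_{X⊃□, X∈𝒮} α_2(E,X) are independent of □ by
translation invariance. We have also used Σ_{X⊃□, X∈𝒮} α_{2,μ}(E,X) = 0 which follows by choosing x⁰ in the center of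
□ and using α_{2,μ}(E, r_μX) = −α_{2,μ}(E,X) where r_μ is reflection thru the plane x_μ = x⁰_μ."*  LEMMA study
(L1824–1836): *"|ε(E)| ≤ 𝒪(1)‖E‖_{k,κ}, |μ(E)| ≤ 𝒪(1)λ_k^{1/2+6ε}‖E‖_{k,κ}"*, proof: *"For the first bound we have ε(E) ≤
Σ_{X⊃□}‖E(X)‖_k ≤ K_0‖E‖_{k,κ} as in (summing). The second bound uses (saint) and follows in the same way."*

**What is reproduced here (kernel-checked, zero `sorry`).**  Fields are real functions `φ : Λ → ℝ` on a finite set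
of sites `Λ` (print: the lattice `𝕋^{−k}_{M+N−k}`); polymers are finite sets `X : Finset C` of "M-cubes" `C`; the
integral over a cube is ANY linear functional `cint □ : (Λ → ℝ) →ₗ[ℝ] ℝ` (print: `∫_□ f = Σ_{x∈□} η³f(x)`), so that
`∫_X f = Σ_{□∈X}∫_□ f` (`pint`), `Vol(X) = ∫_X 1` (`vol`), `Vol(𝕋) = Σ_□∫_□ 1`, `‖φ‖² = Σ_□∫_□ φ²`; the coordinate functions
`x_μ` are any fields `coord μ : Λ → ℝ` and the lattice derivatives any linear maps `∂ μ : (Λ → ℝ) →ₗ[ℝ] (Λ → ℝ)`.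
* §1 `E₂(X, 0; f, g)` AS THE ITERATED FRÉCHET DERIVATIVE `D2 G f g = D(φ ↦ DG(φ)g)(0)f` of `G = E(X,·)` (for `C²`
  functionals this is the printed `∂²/∂t₁∂t₂ G(t₁f + t₂g)|₀`; reading (i)), with its algebra PROVED for `C²` functionals
  on any real normed space: `D2_add`, `D2_sub`, `D2_const_mul`, `D2_sum`, `D2_const`, `D2_smul_right`, `D2_sub_right`,
  `D2_comp_clm` (chain rule under a continuous linear map), and **`D2_quad`**: for the quadratic functional `φ ↦ B(φ,φ)`
  of a continuous bilinear form, `E₂(·;f,g) = B(f,g) + B(g,f)`.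
* §2 the polymer integrals `pint`, `vol` and the two counterterms of (renorm) as continuous bilinear forms `sqForm X`
  (`(f,g) ↦ ∫_X fg`) and `derivForm X (der μ)` (`(f,g) ↦ ∫_X f ∂_μg`).
* §3 (normalization) and (renorm) VERBATIM: `IsNormalized`, `alpha0`, `alpha2`, `alpha2d` (with the base point `x⁰` a
  parameter `c`), `renorm` (= `𝓡`, by cases small∕large); **`alpha2d_baseIndep`** (*"The last is independent of the base
  point x⁰"*, L1750 — for `Vol(X) ≠ 0`); **`isNormalized_renorm`** (*"it is straightforward to check that 𝓡E is
  normalized for small polymers"*, L1751) under exactly the inputs the check uses: `E(X,·)` is `C²`, `Vol(X) ≠ 0`, the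
  derivatives kill constants (`∂ μ 1 = 0`) and differentiate the coordinates correctly ON `X` (`∫_X ∂_μ x_ν = δ_{μν}Vol(X)`);
  `renorm_of_not_small` (*"If X is large then 𝓡E(X) = E(X)"*).
* §4 (renorm2): `epsAt □ = −Σ_{X⊃□, X∈𝒮}α₀(E,X)`, `halfMuAt □`, `alpha2dAt □ μ` (L1811–1818, read at the cube `□`), the
  Fubini step `sum_small_mul_pint`, and **`renorm2`**: IF `epsAt`, `halfMuAt` do not depend on `□` and `alpha2dAt □ μ = 0`
  for all `□, μ` THEN `Σ_{X∈𝒟}E(X,φ) = −ε·Vol(𝕋) − ½μ‖φ‖² + Σ_{X∈𝒟}𝓡E(X,φ)` for every field — this is exactly the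
  hypothesis shape `SmallFieldStepAssembly.Extracted.eq` (the (renorm2) input of the §4.7–4.8 assembly, this lineage)
  for polymer activities; §7 (v1.1) packages it as that structure: **`toExtracted`** (with `μ = 2·halfMuAt`, the norms
  `‖F‖`, `‖𝓡F‖` free parameters — their bounds are LEMMA 13's business), `toExtracted_F`, `toExtracted_R`.
* §5 THE TWO SYMMETRY FACTS from condition (d.) of `𝒦_k`: a lattice symmetry is typed as a pair (cube permutation
  `τ : C ≃ C`, field map `P : (Λ → ℝ) →L[ℝ] (Λ → ℝ)`, print: `(Pφ)(x) = φ(s x)`) with `E(τX, φ) = E(X, Pφ)`, `P1 = 1`,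
  `∫_{τX} h = ∫_X Ph`; **`alpha0_map`**, **`alpha2_map`** (invariance of `α₀, α₂`), **`sum_smallAt_map`** (reindexing
  `{X ∈ 𝒮 : X ∋ τ□} ↔ {X ∈ 𝒮 : X ∋ □}`), **`epsAt_map`**∕**`halfMuAt_map`** (*"independent of □ by translation
  invariance"*: `epsAt (τ□) = epsAt □`), and for a REFLECTION (`τ□ = □`, `P(x_μ − x⁰_μ) = −(x_μ − x⁰_μ)`):
  **`alpha2d_reflect`** (*"α_{2,μ}(E, r_μX) = −α_{2,μ}(E,X)"*) and **`alpha2dAt_eq_zero_of_reflection`**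
  (*"Σ_{X⊃□, X∈𝒮} α_{2,μ}(E,X) = 0"*, for ANY base point, via `alpha2d_baseIndep`).
* §6 LEMMA study's MECHANISM: **`abs_epsAt_le`** — `|ε(E)| ≤ Σ_{X⊃□}|E(X,0)| ≤ N·K₀` from `Vol(X) ≥ 1`, a pointwise
  majorant `|E(X,0)| ≤ ‖E(X)‖_k ≤ N e^{−κd_M(X)}` and (summing0) `Σ_{X⊃□}e^{−κd_M(X)} ≤ K₀` (inputs as reals); and
  **`abs_twice_halfMuAt_le`** — the same with (saint) `|E_2(X,0;1,1)| ≤ s‖E(X)‖_k` as input: `|μ(E)| ≤ s·N·K₀`.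

**Readings ∕ divergences (declared).**  (i) `E_2(X,0;f_1,f_2)` is typed as the iterated Fréchet derivative at `0`
(direction `f_2` first, then `f_1`); for the `C²` functionals of the paper (analytic on `𝓡_k`, condition (b.)) this is
the printed mixed partial `∂²/∂t₁∂t₂E(X, t₁f₁ + t₂f₂)|₀`; differentiability (`ContDiff ℝ 2`) is the hypothesis under
which the algebra of §1 holds.  (ii) ABSTRACT GEOMETRY: sites, cubes, cube integrals, coordinates and derivatives are
parameters; the torus `𝕋^{−k}_{M+N−k}`, `η = L^{−k}`, the forward derivative and the `M`-cube partition are ONE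
instance; the only geometric facts used by the normalization check are typed as its hypotheses ON THE POLYMER `X`
(`∫_X ∂_μ x_ν = δ_{μν}Vol(X)`, `∂_μ1 = 0`) — on a torus the coordinates `x_μ` exist only locally, which is all the print
needs for small polymers.  (iii) TRANSLATION INVARIANCE ∕ REFLECTION: §5 proves the two facts from a typed symmetry
`(τ, P)` leaving `E`, the cube integrals, the family `𝒟` and smallness invariant; that the torus translations act
transitively on cubes and that each cube has the reflections `r_μ` through its centre (L1820–1821) is the instance,
not re-derived here; `renorm2` takes the two facts as hypotheses so that either route (symmetry, or direct) feeds it.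
(iv) `Vol(X) ≠ 0` (resp. `≥ 1` in §6) is explicit (print: `X` nonempty, `Vol(X) ≥ M³`).  (v) LEMMA study is reproduced
as its MECHANISM (finite sums, `Vol ≥ 1`, a pointwise majorant and (summing0) as real inputs); the norm `‖E(X)‖_k =
sup_{φ∈𝓡_k}|E(X,φ)|` (which dominates `|E(X,0)|` since `0 ∈ 𝓡_k`) and the Cauchy bound (saint) are inputs, not typed.

**What is NOT claimed.**  LEMMA rlem (`‖𝓡E(X)‖_k ≤ 𝒪(1)‖E(X)‖_k`, L1759–1799 — needs the domain `𝓡_k` and (awkward)),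
(saint), (summing0), analyticity∕parity (conditions (b.), (c.)) — not asserted; the torus instance of §5's symmetries is
not constructed; nothing of B1–B16 is touched (TEMPLATE.md §4.1 row «D1 §3.4–3.5» ↔ B12 p.258 + §§3–5: expansion in
local Landau coordinates, Ward identities, β·A^η marginal — grade P∕N there; YM has no mass term and Dimock *"avoid[s]
perturbation theory entirely"* — untouched).  NOT summit progress; NOT a statement about any Bałaban paper; NOT
continuum; NOT Clay.  Leaf of v1 (import Mathlib); v1.1 imports `…Dimock2011to13.SmallFieldStepAssembly` (itself
`import Mathlib`) for the bridge §7 only and is otherwise v1 verbatim; sub-namespace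
`…Dimock2011to13.NormalizationExtraction`; modifies nothing.  Unit `b2b-balaban-template` gen 32 (journal CLAIM
D1-NORMALIZATION-KERNEL (v1), D1-NORMALIZATION-BRIDGE (v1.1)); cell records TEMPLATE.md §4.1 row «D1 §3.4–3.5», §15.2;
GAPS C-tmpl32-2, C-tmpl32-5.
-/

noncomputable section

open Finset
open scoped BigOperators

namespace Literature.MathematicalPhysics.QuantumFieldTheory.Dimock2011to13.NormalizationExtraction

/-! ## §1 `E₂(X, 0; f, g)` as an iterated Fréchet derivative, and its algebra for `C²` functionals -/

section D2

variable {F : Type*} [NormedAddCommGroup F] [NormedSpace ℝ F]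

/-- `E_2(X, 0; f_1, f_2)` for `G = E(X, ·)`: the derivative of `φ ↦ DG(φ)f_2` at `0` in the direction `f_1` — for `C²`
functionals the printed *"E_n(X, φ; f_1, …, f_n) = ∂ⁿ/∂t_1⋯∂t_n E_n(X, φ + t_1f_1 + ⋯ + t_nf_n)|_{t_i=0}"* at `φ = 0`,
`n = 2` (reading (i) of the module header). [cite: Dimock2013, §3.5 eq. (normalization) (arXiv:1108.1335v2 TeX
L1526–1533)] -/
def D2 (G : F → ℝ) (f g : F) : ℝ := fderiv ℝ (fun φ => fderiv ℝ G φ g) 0 f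

/-- for a `C²` functional, `φ ↦ DG(φ)g` is differentiable (so that `E_2` is defined by honest derivatives). [cite: Dimock2013,
§3.5 eq. (normalization) (arXiv:1108.1335v2 TeX L1526–1533)] -/
theorem differentiable_fderiv_apply {G : F → ℝ} (hG : ContDiff ℝ 2 G) (g : F) :
    Differentiable ℝ (fun φ => fderiv ℝ G φ g) := by
  have h1 : ContDiff ℝ 1 (fderiv ℝ G) := hG.fderiv_right (by norm_num)
  have h2 : Differentiable ℝ (fderiv ℝ G) := h1.differentiable (by norm_num)
  exact h2.clm_apply (differentiable_const g)

/-- `E_2` is additive in `E` (for `C²` functionals). [cite: Dimock2013, §3.5 (arXiv:1108.1335v2 TeX L1526–1533)] -/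
theorem D2_add {G H : F → ℝ} (hG : ContDiff ℝ 2 G) (hH : ContDiff ℝ 2 H) (f g : F) :
    D2 (fun φ => G φ + H φ) f g = D2 G f g + D2 H f g := by
  unfold D2
  have hG1 : Differentiable ℝ G := hG.differentiable (by norm_num)
  have hH1 : Differentiable ℝ H := hH.differentiable (by norm_num)
  have : (fun φ => fderiv ℝ (fun φ => G φ + H φ) φ g) = fun φ => fderiv ℝ G φ g + fderiv ℝ H φ g := by
    funext φ; rw [fderiv_fun_add (hG1 φ) (hH1 φ)]; rfl
  rw [this, fderiv_fun_add ((differentiable_fderiv_apply hG g) 0) ((differentiable_fderiv_apply hH g) 0)]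
  rfl

/-- `E_2` is homogeneous in `E`. [cite: Dimock2013, §3.5 (arXiv:1108.1335v2 TeX L1526–1533)] -/
theorem D2_const_mul {G : F → ℝ} (hG : ContDiff ℝ 2 G) (c : ℝ) (f g : F) :
    D2 (fun φ => c * G φ) f g = c * D2 G f g := by
  unfold D2
  have hG1 : Differentiable ℝ G := hG.differentiable (by norm_num)
  have : (fun φ => fderiv ℝ (fun φ => c * G φ) φ g) = fun φ => c * fderiv ℝ G φ g := by
    funext φ; rw [fderiv_const_mul (hG1 φ)]; rfl
  rw [this, fderiv_const_mul ((differentiable_fderiv_apply hG g) 0)]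
  simp

/-- `E_2` of a difference. [cite: Dimock2013, §3.5 (arXiv:1108.1335v2 TeX L1526–1533)] -/
theorem D2_sub {G H : F → ℝ} (hG : ContDiff ℝ 2 G) (hH : ContDiff ℝ 2 H) (f g : F) :
    D2 (fun φ => G φ - H φ) f g = D2 G f g - D2 H f g := by
  have hH' : ContDiff ℝ 2 (fun φ => (-1 : ℝ) * H φ) := contDiff_const.mul hH
  have h := D2_add hG hH' f g
  rw [D2_const_mul hH] at h
  have e : (fun φ => G φ + (-1 : ℝ) * H φ) = fun φ => G φ - H φ := by funext φ; ring
  rw [e] at h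
  rw [h]; ring

/-- `E_2` of a finite sum of `C²` functionals. [cite: Dimock2013, §3.5 (arXiv:1108.1335v2 TeX L1526–1533)] -/
theorem D2_sum {ι : Type*} (s : Finset ι) (G : ι → F → ℝ) (hG : ∀ i ∈ s, ContDiff ℝ 2 (G i)) (f g : F) :
    D2 (fun φ => ∑ i ∈ s, G i φ) f g = ∑ i ∈ s, D2 (G i) f g := by
  classical
  induction s using Finset.induction_on with
  | empty => simp [D2]
  | insert a s ha ih =>
    have hGa : ContDiff ℝ 2 (G a) := hG a (Finset.mem_insert_self a s)
    have hGs : ∀ i ∈ s, ContDiff ℝ 2 (G i) := fun i hi => hG i (Finset.mem_insert_of_mem hi)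
    have hsum : ContDiff ℝ 2 (fun φ => ∑ i ∈ s, G i φ) := ContDiff.sum fun i hi => hGs i hi
    simp only [Finset.sum_insert ha]
    rw [D2_add hGa hsum, ih hGs]

/-- `E_2` of a constant functional vanishes (the `Vol(X)` counterterm). [cite: Dimock2013, §3.5 (arXiv:1108.1335v2 TeX
L1526–1533)] -/
theorem D2_const (c : ℝ) (f g : F) : D2 (fun _ : F => c) f g = 0 := by
  unfold D2; simp

/-- `E_2(X,0;f,·)` is homogeneous in the second direction. [cite: Dimock2013, §3.5 (arXiv:1108.1335v2 TeX L1526–1533)] -/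
theorem D2_smul_right {G : F → ℝ} (hG : ContDiff ℝ 2 G) (f g : F) (c : ℝ) :
    D2 G f (c • g) = c * D2 G f g := by
  unfold D2
  have : (fun φ => fderiv ℝ G φ (c • g)) = fun φ => c * fderiv ℝ G φ g := by
    funext φ; rw [map_smul]; rfl
  rw [this, fderiv_const_mul ((differentiable_fderiv_apply hG g) 0)]
  simp

/-- `E_2(X,0;f,·)` is subtractive in the second direction. [cite: Dimock2013, §3.5 (arXiv:1108.1335v2 TeX L1526–1533)] -/
theorem D2_sub_right {G : F → ℝ} (hG : ContDiff ℝ 2 G) (f g h : F) :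
    D2 G f (g - h) = D2 G f g - D2 G f h := by
  unfold D2
  have : (fun φ => fderiv ℝ G φ (g - h)) = fun φ => fderiv ℝ G φ g - fderiv ℝ G φ h := by
    funext φ; rw [map_sub]
  rw [this, fderiv_fun_sub ((differentiable_fderiv_apply hG g) 0) ((differentiable_fderiv_apply hG h) 0)]
  rfl

/-- CHAIN RULE for `E_2` under a continuous linear field map `P` (a lattice symmetry acting on fields):
`E_2` of `φ ↦ G(Pφ)` at `(f,g)` is `E_2` of `G` at `(Pf, Pg)`. [cite: Dimock2013, §3.3 condition (d.) and §3.5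
(arXiv:1108.1335v2 TeX L1305, L1815–1821)] -/
theorem D2_comp_clm {G : F → ℝ} (hG : ContDiff ℝ 2 G) (P : F →L[ℝ] F) (f g : F) :
    D2 (fun φ => G (P φ)) f g = D2 G (P f) (P g) := by
  unfold D2
  have hG1 : Differentiable ℝ G := hG.differentiable (by norm_num)
  have h1 : (fun φ => fderiv ℝ (fun φ => G (P φ)) φ g) = fun φ => (fun ψ => fderiv ℝ G ψ (P g)) (P φ) := by
    funext φ
    have hc : HasFDerivAt (fun φ => G (P φ)) ((fderiv ℝ G (P φ)).comp P) φ :=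
      (hG1 (P φ)).hasFDerivAt.comp φ P.hasFDerivAt
    rw [hc.fderiv]; rfl
  rw [h1]
  have hd : DifferentiableAt ℝ (fun ψ => fderiv ℝ G ψ (P g)) (P 0) := (differentiable_fderiv_apply hG (P g)) _
  have hc2 : HasFDerivAt (fun φ => (fun ψ => fderiv ℝ G ψ (P g)) (P φ))
      ((fderiv ℝ (fun ψ => fderiv ℝ G ψ (P g)) (P 0)).comp P) 0 :=
    hd.hasFDerivAt.comp (0 : F) P.hasFDerivAt
  rw [hc2.fderiv, map_zero]; rfl

/-- the quadratic functional `φ ↦ B(φ,φ)` of a continuous bilinear form (the shape of the counterterms `∫_Xφ²`,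
`∫_Xφ∂_μφ`). [cite: Dimock2013, §3.5 eq. (renorm) (arXiv:1108.1335v2 TeX L1734–1741)] -/
def quad (B : F →L[ℝ] F →L[ℝ] ℝ) (φ : F) : ℝ := B φ φ

/-- quadratic functionals (the counterterms of (renorm)) are smooth. [cite: Dimock2013, §3.5 eq. (renorm) (arXiv:1108.1335v2
TeX L1734–1741)] -/
theorem contDiff_quad (B : F →L[ℝ] F →L[ℝ] ℝ) {n : WithTop ℕ∞} : ContDiff ℝ n (quad B) :=
  B.isBoundedBilinearMap.contDiff.comp (contDiff_id.prodMk contDiff_id)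

/-- `D(B(φ,φ))(h) = B(φ,h) + B(h,φ)` — the first derivative of a counterterm of (renorm). [cite: Dimock2013, §3.5 eqs.
(normalization), (renorm) (arXiv:1108.1335v2 TeX L1526–1533, L1734–1741)] -/
theorem fderiv_quad_apply (B : F →L[ℝ] F →L[ℝ] ℝ) (φ h : F) :
    fderiv ℝ (quad B) φ h = B φ h + B h φ := by
  have := (B.hasFDerivAt_of_bilinear (hasFDerivAt_id φ) (hasFDerivAt_id φ)).fderiv
  unfold quad
  simp only [id] at this
  rw [this]
  simp

/-- **`E_2` OF A QUADRATIC COUNTERTERM**: `E_2(·, 0; f, g) = B(f,g) + B(g,f)` for `φ ↦ B(φ,φ)`. [cite: Dimock2013, §3.5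
eqs. (normalization), (renorm) (arXiv:1108.1335v2 TeX L1517–1533, L1734–1751)] -/
theorem D2_quad (B : F →L[ℝ] F →L[ℝ] ℝ) (f g : F) : D2 (quad B) f g = B f g + B g f := by
  unfold D2
  have : (fun φ => fderiv ℝ (quad B) φ g) = fun φ => (B.flip g + B g) φ := by
    funext φ; rw [fderiv_quad_apply]; simp
  rw [this, ContinuousLinearMap.fderiv]
  simp

/-- `quad B 0 = 0`: the quadratic counterterms vanish at `φ = 0` (first line of (normalization)). [cite: Dimock2013, §3.5 eq.
(normalization) (arXiv:1108.1335v2 TeX L1517–1524)] -/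
@[simp] theorem quad_zero (B : F →L[ℝ] F →L[ℝ] ℝ) : quad B 0 = 0 := by simp [quad]

end D2

/-! ## §2 Polymer integrals and the two counterterms as bilinear forms -/

section Lattice

variable {Λ : Type*} [Fintype Λ] {C : Type*} {ι : Type*}

/-- `∫_X f = Σ_{□∈X} ∫_□ f` — the integral over a polymer (a finite set of `M`-cubes) as a linear functional of the field,
the cube integrals `∫_□` being ANY linear functionals (print: `Σ_{x∈□}η³f(x)`; reading (ii)). [cite: Dimock2013, §3.5
eq. (renorm) (arXiv:1108.1335v2 TeX L1734–1741)] -/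
def pint (cint : C → (Λ → ℝ) →ₗ[ℝ] ℝ) (X : Finset C) : (Λ → ℝ) →ₗ[ℝ] ℝ := ∑ b ∈ X, cint b

omit [Fintype Λ] in
/-- `∫_X f = Σ_{□∈X}∫_□ f`. [cite: Dimock2013, §3.5 eq. (renorm) (arXiv:1108.1335v2 TeX L1734–1741)] -/
theorem pint_apply (cint : C → (Λ → ℝ) →ₗ[ℝ] ℝ) (X : Finset C) (f : Λ → ℝ) :
    pint cint X f = ∑ b ∈ X, cint b f := by
  simp [pint, LinearMap.sum_apply]

/-- `Vol(X) = ∫_X 1`. [cite: Dimock2013, §3.5 eq. (renorm) (arXiv:1108.1335v2 TeX L1737, L1745)] -/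
def vol (cint : C → (Λ → ℝ) →ₗ[ℝ] ℝ) (X : Finset C) : ℝ := pint cint X 1

omit [Fintype Λ] in
/-- `(f,g) ↦ ∫_X fg` is bilinear. [folklore] -/
private theorem sq_bilin (cint : C → (Λ → ℝ) →ₗ[ℝ] ℝ) (X : Finset C) :
    (∀ f₁ f₂ g : Λ → ℝ, pint cint X ((f₁ + f₂) * g) = pint cint X (f₁ * g) + pint cint X (f₂ * g)) ∧
    (∀ (c : ℝ) (f g : Λ → ℝ), pint cint X ((c • f) * g) = c • pint cint X (f * g)) ∧
    (∀ f g₁ g₂ : Λ → ℝ, pint cint X (f * (g₁ + g₂)) = pint cint X (f * g₁) + pint cint X (f * g₂)) ∧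
    (∀ (c : ℝ) (f g : Λ → ℝ), pint cint X (f * (c • g)) = c • pint cint X (f * g)) := by
  refine ⟨fun f₁ f₂ g => ?_, fun c f g => ?_, fun f g₁ g₂ => ?_, fun c f g => ?_⟩
  · rw [add_mul, map_add]
  · rw [smul_mul_assoc, map_smul]
  · rw [mul_add, map_add]
  · rw [mul_smul_comm, map_smul]

/-- the counterterm `∫_Xφ²` as the continuous bilinear form `(f,g) ↦ ∫_X fg` on the (finite-dimensional) field space.
[cite: Dimock2013, §3.5 eq. (renorm) (arXiv:1108.1335v2 TeX L1734–1741)] -/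
def sqForm (cint : C → (Λ → ℝ) →ₗ[ℝ] ℝ) (X : Finset C) : (Λ → ℝ) →L[ℝ] (Λ → ℝ) →L[ℝ] ℝ :=
  (LinearMap.mk₂ ℝ (fun f g => pint cint X (f * g)) (sq_bilin cint X).1 (sq_bilin cint X).2.1
    (sq_bilin cint X).2.2.1 (sq_bilin cint X).2.2.2).toContinuousBilinearMap

/-- `sqForm X f g = ∫_X fg`. [cite: Dimock2013, §3.5 eq. (renorm) (arXiv:1108.1335v2 TeX L1734–1741)] -/
@[simp] theorem sqForm_apply (cint : C → (Λ → ℝ) →ₗ[ℝ] ℝ) (X : Finset C) (f g : Λ → ℝ) :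
    sqForm cint X f g = pint cint X (f * g) := rfl

omit [Fintype Λ] in
/-- `(f,g) ↦ ∫_X f∂g` is bilinear for a linear `∂`. [folklore] -/
private theorem deriv_bilin (cint : C → (Λ → ℝ) →ₗ[ℝ] ℝ) (X : Finset C) (D : (Λ → ℝ) →ₗ[ℝ] (Λ → ℝ)) :
    (∀ f₁ f₂ g : Λ → ℝ, pint cint X ((f₁ + f₂) * D g) = pint cint X (f₁ * D g) + pint cint X (f₂ * D g)) ∧
    (∀ (c : ℝ) (f g : Λ → ℝ), pint cint X ((c • f) * D g) = c • pint cint X (f * D g)) ∧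
    (∀ f g₁ g₂ : Λ → ℝ, pint cint X (f * D (g₁ + g₂)) = pint cint X (f * D g₁) + pint cint X (f * D g₂)) ∧
    (∀ (c : ℝ) (f g : Λ → ℝ), pint cint X (f * D (c • g)) = c • pint cint X (f * D g)) := by
  refine ⟨fun f₁ f₂ g => ?_, fun c f g => ?_, fun f g₁ g₂ => ?_, fun c f g => ?_⟩
  · rw [add_mul, map_add]
  · rw [smul_mul_assoc, map_smul]
  · rw [map_add, mul_add, map_add]
  · rw [map_smul, mul_smul_comm, map_smul]

/-- the counterterm `∫_Xφ∂_μφ` as the continuous bilinear form `(f,g) ↦ ∫_X f ∂_μg`. [cite: Dimock2013, §3.5 eq. (renorm)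
(arXiv:1108.1335v2 TeX L1734–1741)] -/
def derivForm (cint : C → (Λ → ℝ) →ₗ[ℝ] ℝ) (X : Finset C) (D : (Λ → ℝ) →ₗ[ℝ] (Λ → ℝ)) :
    (Λ → ℝ) →L[ℝ] (Λ → ℝ) →L[ℝ] ℝ :=
  (LinearMap.mk₂ ℝ (fun f g => pint cint X (f * D g)) (deriv_bilin cint X D).1 (deriv_bilin cint X D).2.1
    (deriv_bilin cint X D).2.2.1 (deriv_bilin cint X D).2.2.2).toContinuousBilinearMap

/-- `derivForm X ∂ f g = ∫_X f∂g`. [cite: Dimock2013, §3.5 eq. (renorm) (arXiv:1108.1335v2 TeX L1734–1741)] -/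
@[simp] theorem derivForm_apply (cint : C → (Λ → ℝ) →ₗ[ℝ] ℝ) (X : Finset C) (D : (Λ → ℝ) →ₗ[ℝ] (Λ → ℝ))
    (f g : Λ → ℝ) : derivForm cint X D f g = pint cint X (f * D g) := rfl

omit [Fintype Λ] in
/-- a constant field `x ↦ c` (the base point `x⁰_μ` of (renorm)) is `c·1` (footnote L1518: *"1 means the function x → 1"*).
[cite: Dimock2013, §3.5 (arXiv:1108.1335v2 TeX L1518, L1747)] -/
theorem const_eq_smul_one (c : ℝ) : (fun _ : Λ => c) = c • (1 : Λ → ℝ) := by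
  funext x; simp

/-! ## §3 Normalization (normalization) and the operator `𝓡` (renorm) -/

/-- **NORMALIZED** (L1517–1524), verbatim: *"The functional E ∈ 𝒦_k is said to be normalized if E(X,0) = 0, E_2(X, 0;
1,1) = 0, E_2(X, 0; 1,x_μ) = 0"* (for the given polymer; `1` = the constant field, `x_μ` = `coord μ`). [cite: Dimock2013,
§3.5 eq. (normalization) (arXiv:1108.1335v2 TeX L1517–1524)] -/
def IsNormalized (coord : ι → Λ → ℝ) (G : (Λ → ℝ) → ℝ) : Prop :=
  G 0 = 0 ∧ D2 G 1 1 = 0 ∧ ∀ μ, D2 G 1 (coord μ) = 0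

/-- `α_0(E,X) = (1/Vol(X)) E(X,0)` (L1745). [cite: Dimock2013, §3.5 eq. (renorm) coefficients (arXiv:1108.1335v2 TeX
L1743–1749)] -/
def alpha0 (cint : C → (Λ → ℝ) →ₗ[ℝ] ℝ) (E : Finset C → (Λ → ℝ) → ℝ) (X : Finset C) : ℝ :=
  E X 0 / vol cint X

/-- `α_2(E,X) = (1/(2Vol(X))) E_2(X, 0; 1,1)` (L1745–1746). [cite: Dimock2013, §3.5 eq. (renorm) coefficients
(arXiv:1108.1335v2 TeX L1743–1749)] -/
def alpha2 (cint : C → (Λ → ℝ) →ₗ[ℝ] ℝ) (E : Finset C → (Λ → ℝ) → ℝ) (X : Finset C) : ℝ :=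
  D2 (E X) 1 1 / (2 * vol cint X)

/-- `α_{2,μ}(E,X) = (1/Vol(X))(E_2(X, 0; 1, x_μ − x⁰_μ) − (1/Vol(X))E_2(X, 0; 1,1)∫_X(x_μ − x⁰_μ))` (L1747), with the base
point `x⁰ = c` an explicit parameter. [cite: Dimock2013, §3.5 eq. (renorm) coefficients (arXiv:1108.1335v2 TeX
L1743–1750)] -/
def alpha2d (cint : C → (Λ → ℝ) →ₗ[ℝ] ℝ) (coord : ι → Λ → ℝ) (c : ι → ℝ) (E : Finset C → (Λ → ℝ) → ℝ)
    (X : Finset C) (μ : ι) : ℝ :=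
  (D2 (E X) 1 (coord μ - fun _ => c μ) -
      D2 (E X) 1 1 / vol cint X * pint cint X (coord μ - fun _ => c μ)) / vol cint X

/-- THE COUNTERTERM of (renorm) for a small polymer: `α_0Vol(X) + α_2∫_Xφ² + Σ_μα_{2,μ}∫_Xφ∂_μφ` (L1736–1739).
[cite: Dimock2013, §3.5 eq. (renorm) (arXiv:1108.1335v2 TeX L1734–1741)] -/
def counter [Fintype ι] (cint : C → (Λ → ℝ) →ₗ[ℝ] ℝ) (coord : ι → Λ → ℝ) (c : ι → ℝ)
    (der : ι → (Λ → ℝ) →ₗ[ℝ] (Λ → ℝ)) (E : Finset C → (Λ → ℝ) → ℝ) (X : Finset C) (φ : Λ → ℝ) : ℝ :=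
  alpha0 cint E X * vol cint X + alpha2 cint E X * pint cint X (φ * φ) +
    ∑ μ, alpha2d cint coord c E X μ * pint cint X (φ * der μ φ)

/-- **THE OPERATOR `𝓡`** (L1730–1751), verbatim: *"If X is small (X ∈ 𝒮) then 𝓡E(X) is defined by E(X, φ) = α_0(E,X)Vol(X)
+ α_2(E,X)∫_Xφ² + Σ_μα_{2,μ}(E,X)∫_Xφ∂_μφ + 𝓡E(X, φ) … If X is large then 𝓡E(X) = E(X)"*. [cite: Dimock2013, §3.5 eq.
(renorm) (arXiv:1108.1335v2 TeX L1730–1751)] -/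
def renorm [Fintype ι] (cint : C → (Λ → ℝ) →ₗ[ℝ] ℝ) (coord : ι → Λ → ℝ) (c : ι → ℝ)
    (der : ι → (Λ → ℝ) →ₗ[ℝ] (Λ → ℝ)) (small : Finset C → Prop) [DecidablePred small]
    (E : Finset C → (Λ → ℝ) → ℝ) (X : Finset C) : (Λ → ℝ) → ℝ :=
  fun φ => if small X then E X φ - counter cint coord c der E X φ else E X φ

variable {cint : C → (Λ → ℝ) →ₗ[ℝ] ℝ} {coord : ι → Λ → ℝ} {c : ι → ℝ} {der : ι → (Λ → ℝ) →ₗ[ℝ] (Λ → ℝ)}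
  {small : Finset C → Prop} [DecidablePred small] {E : Finset C → (Λ → ℝ) → ℝ} {X : Finset C}

section Renorm

variable [Fintype ι]

/-- *"If X is large then 𝓡E(X) = E(X)"* (L1751). [cite: Dimock2013, §3.5 eq. (renorm) (arXiv:1108.1335v2 TeX L1751)] -/
theorem renorm_of_not_small (hX : ¬ small X) : renorm cint coord c der small E X = E X := by
  funext φ; simp [renorm, hX]

/-- for a small polymer `𝓡E(X,φ) = E(X,φ) − (counterterm)` (L1736–1739). [cite: Dimock2013, §3.5 eq. (renorm)
(arXiv:1108.1335v2 TeX L1734–1741)] -/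
theorem renorm_of_small (hX : small X) :
    renorm cint coord c der small E X = fun φ => E X φ - counter cint coord c der E X φ := by
  funext φ; simp [renorm, hX]

/-- (renorm) as printed: `E(X,φ) = α_0Vol(X) + α_2∫_Xφ² + Σ_μα_{2,μ}∫_Xφ∂_μφ + 𝓡E(X,φ)` for small `X`. [cite: Dimock2013,
§3.5 eq. (renorm) (arXiv:1108.1335v2 TeX L1734–1741)] -/
theorem renorm_eq (hX : small X) (φ : Λ → ℝ) :
    E X φ = alpha0 cint E X * vol cint X + alpha2 cint E X * pint cint X (φ * φ) +
      ∑ μ, alpha2d cint coord c E X μ * pint cint X (φ * der μ φ) + renorm cint coord c der small E X φ := by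
  rw [renorm_of_small hX]; simp only [counter]; ring

omit [DecidablePred small] in
/-- the counterterm of (renorm) in terms of the bilinear forms of §2. [cite: Dimock2013, §3.5 eq. (renorm) (arXiv:1108.1335v2
TeX L1734–1741)] -/
theorem counter_eq_quad (φ : Λ → ℝ) :
    counter cint coord c der E X φ = alpha0 cint E X * vol cint X + alpha2 cint E X * quad (sqForm cint X) φ +
      ∑ μ, alpha2d cint coord c E X μ * quad (derivForm cint X (der μ)) φ := by
  simp [counter, quad]

omit [DecidablePred small] in
/-- the counterterm of (renorm) is smooth. [cite: Dimock2013, §3.5 eq. (renorm) (arXiv:1108.1335v2 TeX L1734–1741)] -/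
theorem contDiff_counter {n : WithTop ℕ∞} : ContDiff ℝ n (counter cint coord c der E X) := by
  have e : counter cint coord c der E X = fun φ => alpha0 cint E X * vol cint X +
      alpha2 cint E X * quad (sqForm cint X) φ +
      ∑ μ, alpha2d cint coord c E X μ * quad (derivForm cint X (der μ)) φ := by
    funext φ; exact counter_eq_quad φ
  rw [e]
  refine (contDiff_const.add (contDiff_const.mul (contDiff_quad _))).add ?_
  exact ContDiff.sum fun μ _ => contDiff_const.mul (contDiff_quad _)

omit [DecidablePred small] in
/-- the counterterm of (renorm) at `φ = 0` is `α_0(E,X)Vol(X)` (= `E(X,0)`). [cite: Dimock2013, §3.5 eq. (renorm)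
(arXiv:1108.1335v2 TeX L1734–1745)] -/
theorem counter_zero : counter cint coord c der E X 0 = alpha0 cint E X * vol cint X := by
  simp [counter]

omit [DecidablePred small] in
/-- `E_2` of the counterterm: `α_2(∫_X fg + ∫_X gf) + Σ_μ α_{2,μ}(∫_X f∂_μg + ∫_X g∂_μf)`. [cite: Dimock2013, §3.5 eqs.
(normalization), (renorm) (arXiv:1108.1335v2 TeX L1517–1533, L1734–1751)] -/
theorem D2_counter (f g : Λ → ℝ) :
    D2 (counter cint coord c der E X) f g = alpha2 cint E X * (pint cint X (f * g) + pint cint X (g * f)) +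
      ∑ μ, alpha2d cint coord c E X μ * (pint cint X (f * der μ g) + pint cint X (g * der μ f)) := by
  have e : counter cint coord c der E X = fun φ => (alpha0 cint E X * vol cint X +
      alpha2 cint E X * quad (sqForm cint X) φ) +
      ∑ μ, alpha2d cint coord c E X μ * quad (derivForm cint X (der μ)) φ := by
    funext φ; exact counter_eq_quad φ
  rw [e]
  have h1 : ContDiff ℝ 2 (fun φ => alpha0 cint E X * vol cint X + alpha2 cint E X * quad (sqForm cint X) φ) :=
    contDiff_const.add (contDiff_const.mul (contDiff_quad _))
  have h2 : ContDiff ℝ 2 (fun φ => ∑ μ, alpha2d cint coord c E X μ * quad (derivForm cint X (der μ)) φ) :=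
    ContDiff.sum fun μ _ => contDiff_const.mul (contDiff_quad _)
  rw [D2_add h1 h2, D2_add contDiff_const (contDiff_const.mul (contDiff_quad _)), D2_const,
    D2_const_mul (contDiff_quad _), D2_quad,
    D2_sum _ _ (fun μ _ => contDiff_const.mul (contDiff_quad _))]
  simp only [sqForm_apply, zero_add]
  congr 1
  refine Finset.sum_congr rfl fun μ _ => ?_
  rw [D2_const_mul (contDiff_quad _), D2_quad]
  simp

omit [Fintype ι] [DecidablePred small] in
/-- **"The last is independent of the base point x⁰"** (L1750): `α_{2,μ}` does not depend on `c` (for a `C²` functional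
and `Vol(X) ≠ 0`). [cite: Dimock2013, §3.5 (arXiv:1108.1335v2 TeX L1747–1750)] -/
theorem alpha2d_baseIndep (hE : ContDiff ℝ 2 (E X)) (hvol : vol cint X ≠ 0) (c c' : ι → ℝ) (μ : ι) :
    alpha2d cint coord c E X μ = alpha2d cint coord c' E X μ := by
  unfold alpha2d
  rw [const_eq_smul_one (c μ), const_eq_smul_one (c' μ), D2_sub_right hE, D2_sub_right hE,
    D2_smul_right hE, D2_smul_right hE, map_sub, map_sub, map_smul, map_smul]
  have hv : pint cint X (1 : Λ → ℝ) = vol cint X := rfl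
  simp only [smul_eq_mul, hv]
  field_simp
  ring

omit [Fintype ι] [DecidablePred small] in
/-- the `x⁰`-free form `α_{2,μ}Vol(X) = E_2(X,0;1,x_μ) − (E_2(X,0;1,1)/Vol(X))∫_X x_μ`. [cite: Dimock2013, §3.5
(arXiv:1108.1335v2 TeX L1747–1750)] -/
theorem alpha2d_mul_vol (hE : ContDiff ℝ 2 (E X)) (hvol : vol cint X ≠ 0) (μ : ι) :
    alpha2d cint coord c E X μ * vol cint X =
      D2 (E X) 1 (coord μ) - D2 (E X) 1 1 / vol cint X * pint cint X (coord μ) := by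
  unfold alpha2d
  rw [const_eq_smul_one (c μ), D2_sub_right hE, D2_smul_right hE, map_sub, map_smul]
  have hv : pint cint X (1 : Λ → ℝ) = vol cint X := rfl
  simp only [smul_eq_mul, hv]
  field_simp
  ring

/-- **"IT IS STRAIGHTFORWARD TO CHECK THAT 𝓡E IS NORMALIZED FOR SMALL POLYMERS"** (L1751) — PROVED for a small polymer
`X` with `Vol(X) ≠ 0`, a `C²` activity `E(X,·)`, derivatives that kill constants (`∂_μ1 = 0`) and differentiate the
coordinates correctly on `X` (`∫_X ∂_μx_ν = δ_{μν}Vol(X)`): then `𝓡E(X,0) = 0`, `(𝓡E)_2(X,0;1,1) = 0`, `(𝓡E)_2(X,0;1,x_ν)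
= 0`. [cite: Dimock2013, §3.5 eqs. (normalization), (renorm) (arXiv:1108.1335v2 TeX L1517–1524, L1730–1751)] -/
theorem isNormalized_renorm [DecidableEq ι] (hX : small X) (hvol : vol cint X ≠ 0) (hE : ContDiff ℝ 2 (E X))
    (h1 : ∀ μ, der μ (1 : Λ → ℝ) = 0)
    (hcoord : ∀ μ ν, pint cint X (der μ (coord ν)) = if μ = ν then vol cint X else 0) :
    IsNormalized coord (renorm cint coord c der small E X) := by
  rw [renorm_of_small hX]
  have hC : ContDiff ℝ 2 (counter cint coord c der E X) := contDiff_counter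
  have hv : pint cint X (1 : Λ → ℝ) = vol cint X := rfl
  refine ⟨?_, ?_, fun ν => ?_⟩
  · -- `𝓡E(X,0) = E(X,0) − α_0Vol(X) = 0`
    simp only [counter_zero, alpha0]
    field_simp
    ring
  · -- `(𝓡E)_2(X,0;1,1) = E_2(1,1) − α_2·2Vol(X) − Σ_μ α_{2,μ}·2∫_X ∂_μ1 = 0`
    rw [D2_sub hE hC, D2_counter]
    simp only [mul_one, h1, mul_zero, map_zero, add_zero, Finset.sum_const_zero, hv, alpha2]
    field_simp
    ring
  · -- `(𝓡E)_2(X,0;1,x_ν) = E_2(1,x_ν) − α_2·2∫_X x_ν − α_{2,ν}Vol(X) = 0`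
    rw [D2_sub hE hC, D2_counter]
    simp only [one_mul, mul_one, h1, mul_zero, map_zero, add_zero, hcoord]
    simp only [mul_ite, mul_zero, Finset.sum_ite_eq', Finset.mem_univ, if_true]
    rw [alpha2d_mul_vol hE hvol ν]
    simp only [alpha2]
    field_simp
    ring

end Renorm

/-! ## §4 The resummation (renorm2) -/

/-- `{X ∈ 𝒮 : X ⊃ □}` — the small polymers of the family `𝒟` containing the cube `□`. [cite: Dimock2013, §3.5 eq.
(renorm2) (arXiv:1108.1335v2 TeX L1808–1815)] -/
def smallAt [DecidableEq C] (small : Finset C → Prop) [DecidablePred small] (D : Finset (Finset C)) (b : C) :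
    Finset (Finset C) :=
  (D.filter small).filter fun X => b ∈ X

omit [Fintype Λ] in
/-- membership in `{X ∈ 𝒮 : X ⊃ □}`. [cite: Dimock2013, §3.5 eq. (renorm2) (arXiv:1108.1335v2 TeX L1808–1815)] -/
theorem mem_smallAt [DecidableEq C] {D : Finset (Finset C)} {b : C} {X : Finset C} :
    X ∈ smallAt small D b ↔ X ∈ D ∧ small X ∧ b ∈ X := by
  simp [smallAt, and_assoc]

/-- `ε(E) = −Σ_{X⊃□, X∈𝒮} α_0(E,X)` (L1811), read at the cube `□`. [cite: Dimock2013, §3.5 eq. (renorm2) (arXiv:1108.1335v2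
TeX L1808–1815)] -/
def epsAt [DecidableEq C] (cint : C → (Λ → ℝ) →ₗ[ℝ] ℝ) (small : Finset C → Prop) [DecidablePred small]
    (E : Finset C → (Λ → ℝ) → ℝ) (D : Finset (Finset C)) (b : C) : ℝ :=
  -∑ X ∈ smallAt small D b, alpha0 cint E X

/-- `½μ(E) = −Σ_{X⊃□, X∈𝒮} α_2(E,X)` (L1812), read at the cube `□`. [cite: Dimock2013, §3.5 eq. (renorm2)
(arXiv:1108.1335v2 TeX L1808–1815)] -/
def halfMuAt [DecidableEq C] (cint : C → (Λ → ℝ) →ₗ[ℝ] ℝ) (small : Finset C → Prop) [DecidablePred small]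
    (E : Finset C → (Λ → ℝ) → ℝ) (D : Finset (Finset C)) (b : C) : ℝ :=
  -∑ X ∈ smallAt small D b, alpha2 cint E X

/-- `Σ_{X⊃□, X∈𝒮} α_{2,μ}(E,X)` (L1818), read at the cube `□`. [cite: Dimock2013, §3.5 eq. (renorm2) (arXiv:1108.1335v2
TeX L1816–1821)] -/
def alpha2dAt [DecidableEq C] (cint : C → (Λ → ℝ) →ₗ[ℝ] ℝ) (coord : ι → Λ → ℝ) (c : ι → ℝ)
    (small : Finset C → Prop) [DecidablePred small] (E : Finset C → (Λ → ℝ) → ℝ) (D : Finset (Finset C))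
    (b : C) (μ : ι) : ℝ :=
  ∑ X ∈ smallAt small D b, alpha2d cint coord c E X μ

omit [Fintype Λ] in
/-- THE FUBINI STEP of (renorm2): `Σ_{X∈𝒮} a(X)·Σ_{□∈X} h(□) = Σ_□ h(□)·Σ_{X∈𝒮, X∋□} a(X)`. [cite: Dimock2013, §3.5 eq.
(renorm2) (arXiv:1108.1335v2 TeX L1802–1815)] -/
theorem sum_small_mul_sum [Fintype C] [DecidableEq C] (D : Finset (Finset C)) (a : Finset C → ℝ) (h : C → ℝ) :
    ∑ X ∈ D.filter small, a X * ∑ b ∈ X, h b = ∑ b, h b * ∑ X ∈ smallAt small D b, a X := by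
  have e1 : ∀ X ∈ D.filter small, a X * ∑ b ∈ X, h b = ∑ b, if b ∈ X then a X * h b else 0 := by
    intro X _
    rw [Finset.mul_sum, ← Finset.sum_filter, Finset.filter_univ_mem]
  rw [Finset.sum_congr rfl e1, Finset.sum_comm]
  refine Finset.sum_congr rfl fun b _ => ?_
  conv_rhs => rw [smallAt, Finset.sum_filter, Finset.mul_sum]
  refine Finset.sum_congr rfl fun X _ => ?_
  split_ifs <;> ring

omit [Fintype Λ] in
/-- the Fubini step for polymer integrals: `Σ_{X∈𝒮} a(X)∫_X h = Σ_□ ∫_□ h · Σ_{X∈𝒮, X∋□} a(X)`. [cite: Dimock2013, §3.5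
eq. (renorm2) (arXiv:1108.1335v2 TeX L1802–1815)] -/
theorem sum_small_mul_pint [Fintype C] [DecidableEq C] (D : Finset (Finset C)) (a : Finset C → ℝ)
    (h : Λ → ℝ) :
    ∑ X ∈ D.filter small, a X * pint cint X h = ∑ b, cint b h * ∑ X ∈ smallAt small D b, a X := by
  simp only [pint_apply]
  exact sum_small_mul_sum D a fun b => cint b h

/-- **(renorm2)** — *"Inserting (renorm) into E = Σ_X E(X) and defining 𝓡E = Σ_X 𝓡E(X) we find we have extracted
energy and mass terms: E = −ε(E)Vol(𝕋_{M+N−k}) − ½μ(E)‖φ‖² + 𝓡E"* (L1802–1807) — PROVED for every finite family `𝒟` of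
polymers from the two facts the print invokes: `ε(E)`, `½μ(E)` read at `□` do not depend on `□` (*"by translation
invariance"*), and `Σ_{X⊃□, X∈𝒮}α_{2,μ}(E,X) = 0` (*"by … reflection"*); here `Vol(𝕋) = Σ_□∫_□1` and `‖φ‖² = Σ_□∫_□φ²`.
[cite: Dimock2013, §3.5 eq. (renorm2) (arXiv:1108.1335v2 TeX L1802–1821)] -/
theorem renorm2 [Fintype C] [DecidableEq C] [Fintype ι] (D : Finset (Finset C)) {eps hmu : ℝ}
    (hT0 : ∀ b, epsAt cint small E D b = eps)
    (hT2 : ∀ b, halfMuAt cint small E D b = hmu) (hR : ∀ b μ, alpha2dAt cint coord c small E D b μ = 0)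
    (φ : Λ → ℝ) :
    ∑ X ∈ D, E X φ = -eps * (∑ b, cint b 1) - hmu * (∑ b, cint b (φ * φ)) +
      ∑ X ∈ D, renorm cint coord c der small E X φ := by
  -- split off the counterterms of the small polymers
  have hsplit : ∑ X ∈ D, E X φ =
      ∑ X ∈ D, renorm cint coord c der small E X φ + ∑ X ∈ D.filter small, counter cint coord c der E X φ := by
    rw [Finset.sum_filter, ← Finset.sum_add_distrib]
    refine Finset.sum_congr rfl fun X _ => ?_
    by_cases hX : small X
    · simp [renorm, hX]
    · simp [renorm, hX]
  -- resum each counterterm over cubes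
  have hc : ∑ X ∈ D.filter small, counter cint coord c der E X φ =
      (∑ X ∈ D.filter small, alpha0 cint E X * pint cint X 1) +
      (∑ X ∈ D.filter small, alpha2 cint E X * pint cint X (φ * φ)) +
      ∑ μ, ∑ X ∈ D.filter small, alpha2d cint coord c E X μ * pint cint X (φ * der μ φ) := by
    simp only [counter, vol, Finset.sum_add_distrib]
    rw [Finset.sum_comm]
  rw [hsplit, hc, sum_small_mul_pint, sum_small_mul_pint]
  have h3 : ∑ μ, ∑ X ∈ D.filter small, alpha2d cint coord c E X μ * pint cint X (φ * der μ φ) = 0 := by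
    refine Finset.sum_eq_zero fun μ _ => ?_
    rw [sum_small_mul_pint]
    refine Finset.sum_eq_zero fun b _ => ?_
    have := hR b μ
    simp only [alpha2dAt] at this
    rw [this, mul_zero]
  have h0 : ∀ b, ∑ X ∈ smallAt small D b, alpha0 cint E X = -eps := fun b => by
    have := hT0 b; simp only [epsAt] at this; linarith
  have h2 : ∀ b, ∑ X ∈ smallAt small D b, alpha2 cint E X = -hmu := fun b => by
    have := hT2 b; simp only [halfMuAt] at this; linarith
  simp only [h0, h2, h3, add_zero]
  rw [← Finset.sum_mul, ← Finset.sum_mul]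
  ring

/-! ## §5 The two symmetry facts: □-independence and the vanishing of `Σα_{2,μ}` -/

section Symmetry

variable (τ : C ≃ C) (P : (Λ → ℝ) →L[ℝ] (Λ → ℝ))

omit [Fintype Λ] [DecidablePred small] in
/-- INVARIANCE OF `α_0` under a lattice symmetry `(τ, P)` of `E` (`E(τX, φ) = E(X, Pφ)`) preserving `Vol`.
[cite: Dimock2013, §3.3 condition (d.) and §3.5 (arXiv:1108.1335v2 TeX L1305, L1815)] -/
theorem alpha0_map (hEX : ∀ φ, E (X.map τ.toEmbedding) φ = E X (P φ))
    (hvol : vol cint (X.map τ.toEmbedding) = vol cint X) :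
    alpha0 cint E (X.map τ.toEmbedding) = alpha0 cint E X := by
  simp only [alpha0, hEX, map_zero, hvol]

omit [DecidablePred small] in
/-- INVARIANCE OF `α_2` under a lattice symmetry `(τ, P)` of `E` with `P1 = 1`, preserving `Vol`, `E(X,·)` being `C²`.
[cite: Dimock2013, §3.3 condition (d.) and §3.5 (arXiv:1108.1335v2 TeX L1305, L1815)] -/
theorem alpha2_map (hE : ContDiff ℝ 2 (E X)) (hEX : ∀ φ, E (X.map τ.toEmbedding) φ = E X (P φ))
    (hP1 : P 1 = 1) (hvol : vol cint (X.map τ.toEmbedding) = vol cint X) :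
    alpha2 cint E (X.map τ.toEmbedding) = alpha2 cint E X := by
  have e : E (X.map τ.toEmbedding) = fun φ => E X (P φ) := funext hEX
  simp only [alpha2, e, D2_comp_clm hE P, hP1, hvol]

omit [Fintype Λ] in
/-- REINDEXING `{X ∈ 𝒮 : X ∋ τ□}` BY `X ↦ τX`: for a family `𝒟` and a smallness predicate invariant under `τ`,
`Σ_{X∈𝒮, X∋τ□} a(X) = Σ_{X∈𝒮, X∋□} a(τX)`. [cite: Dimock2013, §3.5 (arXiv:1108.1335v2 TeX L1815–1821)] -/
theorem sum_smallAt_map [DecidableEq C] {D : Finset (Finset C)} (hD : ∀ X, X.map τ.toEmbedding ∈ D ↔ X ∈ D)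
    (hsm : ∀ X, small (X.map τ.toEmbedding) ↔ small X) (a : Finset C → ℝ) (b : C) :
    ∑ X ∈ smallAt small D (τ b), a X = ∑ X ∈ smallAt small D b, a (X.map τ.toEmbedding) := by
  symm
  refine Finset.sum_equiv τ.finsetCongr (fun X => ?_) (fun X _ => rfl)
  simp only [mem_smallAt, Equiv.finsetCongr_apply, hD, hsm, Finset.mem_map_equiv, Equiv.symm_apply_apply]

omit [Fintype Λ] in
/-- **"INDEPENDENT OF □ BY TRANSLATION INVARIANCE"** (L1815), the `ε`-half: a lattice symmetry `(τ, P)` of ALL the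
activities `E(X,·)`, preserving `𝒟`, smallness and the volumes, carries `ε(E)` read at `□` to `ε(E)` read at `τ□`.
[cite: Dimock2013, §3.5 eq. (renorm2) (arXiv:1108.1335v2 TeX L1808–1815)] -/
theorem epsAt_map [DecidableEq C] {D : Finset (Finset C)} (hD : ∀ X, X.map τ.toEmbedding ∈ D ↔ X ∈ D)
    (hsm : ∀ X, small (X.map τ.toEmbedding) ↔ small X) (hE : ∀ X φ, E (X.map τ.toEmbedding) φ = E X (P φ))
    (hvol : ∀ X, vol cint (X.map τ.toEmbedding) = vol cint X) (b : C) :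
    epsAt cint small E D (τ b) = epsAt cint small E D b := by
  simp only [epsAt, sum_smallAt_map τ hD hsm, alpha0_map τ P (hE _) (hvol _)]

/-- **"INDEPENDENT OF □ BY TRANSLATION INVARIANCE"** (L1815), the `μ`-half (with `P1 = 1` and `C²` activities).
[cite: Dimock2013, §3.5 eq. (renorm2) (arXiv:1108.1335v2 TeX L1808–1815)] -/
theorem halfMuAt_map [DecidableEq C] {D : Finset (Finset C)} (hD : ∀ X, X.map τ.toEmbedding ∈ D ↔ X ∈ D)
    (hsm : ∀ X, small (X.map τ.toEmbedding) ↔ small X) (hC2 : ∀ X, ContDiff ℝ 2 (E X))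
    (hE : ∀ X φ, E (X.map τ.toEmbedding) φ = E X (P φ)) (hP1 : P 1 = 1)
    (hvol : ∀ X, vol cint (X.map τ.toEmbedding) = vol cint X) (b : C) :
    halfMuAt cint small E D (τ b) = halfMuAt cint small E D b := by
  simp only [halfMuAt, sum_smallAt_map τ hD hsm, alpha2_map τ P (hC2 _) (hE _) hP1 (hvol _)]

omit [Fintype Λ] in
/-- □-INDEPENDENCE FROM A TRANSITIVE FAMILY of such symmetries (the torus translations are the instance): `ε(E)` read at
any two cubes agrees. [cite: Dimock2013, §3.5 eq. (renorm2) (arXiv:1108.1335v2 TeX L1808–1815)] -/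
theorem epsAt_eq_of_transitive [DecidableEq C] {D : Finset (Finset C)}
    (hsym : ∀ b b' : C, ∃ (τ : C ≃ C) (P : (Λ → ℝ) →L[ℝ] (Λ → ℝ)), τ b = b' ∧
      (∀ X, X.map τ.toEmbedding ∈ D ↔ X ∈ D) ∧ (∀ X, small (X.map τ.toEmbedding) ↔ small X) ∧
      (∀ X φ, E (X.map τ.toEmbedding) φ = E X (P φ)) ∧ (∀ X, vol cint (X.map τ.toEmbedding) = vol cint X))
    (b b' : C) : epsAt cint small E D b = epsAt cint small E D b' := by
  obtain ⟨τ, P, hb, hD, hsm, hE, hvol⟩ := hsym b b'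
  rw [← hb, epsAt_map τ P hD hsm hE hvol]

omit [DecidablePred small] in
/-- **"α_{2,μ}(E, r_μX) = −α_{2,μ}(E,X) where r_μ is reflection thru the plane x_μ = x⁰_μ"** (L1820–1821): a symmetry
`(τ, P)` of `E` with `P1 = 1`, `∫_{τX}h = ∫_X Ph` and `P(x_μ − x⁰_μ) = −(x_μ − x⁰_μ)` flips the sign of `α_{2,μ}` (base
point `x⁰ = c`). [cite: Dimock2013, §3.5 (arXiv:1108.1335v2 TeX L1816–1821)] -/
theorem alpha2d_reflect (hE : ContDiff ℝ 2 (E X)) (hEX : ∀ φ, E (X.map τ.toEmbedding) φ = E X (P φ))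
    (hP1 : P 1 = 1) (hpint : ∀ h, pint cint (X.map τ.toEmbedding) h = pint cint X (P h)) (μ : ι)
    (hPc : P (coord μ - fun _ => c μ) = -(coord μ - fun _ => c μ)) :
    alpha2d cint coord c E (X.map τ.toEmbedding) μ = -alpha2d cint coord c E X μ := by
  have e : E (X.map τ.toEmbedding) = fun φ => E X (P φ) := funext hEX
  have hvol : vol cint (X.map τ.toEmbedding) = vol cint X := by
    simp only [vol, hpint, hP1]
  simp only [alpha2d, e, D2_comp_clm hE P, hP1, hvol, hpint, hPc, map_neg]
  rw [show -(coord μ - fun _ => c μ) = (-1 : ℝ) • (coord μ - fun _ => c μ) by simp, D2_smul_right hE]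
  ring

/-- **"Σ_{X⊃□, X∈𝒮} α_{2,μ}(E,X) = 0"** (L1816–1821) — PROVED for ANY base point `c`: if the cube `□` admits a reflection
symmetry `(τ, P)` with `τ□ = □`, `τ` preserving `𝒟` and smallness, `(τ, P)` a symmetry of every `E(X,·)` (`C²`,
`Vol(X) ≠ 0` on the small polymers at `□`) with `P1 = 1`, `∫_{τX}h = ∫_XPh`, and `P(x_μ − x⁰_μ) = −(x_μ − x⁰_μ)` for the
reflection centre `x⁰_μ = c₀` (*"choosing x⁰ in the center of □"*), then the sum vanishes. [cite: Dimock2013, §3.5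
(arXiv:1108.1335v2 TeX L1816–1821)] -/
theorem alpha2dAt_eq_zero_of_reflection [DecidableEq C] [DecidableEq ι] {D : Finset (Finset C)} {b : C} (μ : ι)
    (c₀ : ℝ) (hb : τ b = b)
    (hD : ∀ X, X.map τ.toEmbedding ∈ D ↔ X ∈ D) (hsm : ∀ X, small (X.map τ.toEmbedding) ↔ small X)
    (hC2 : ∀ X ∈ smallAt small D b, ContDiff ℝ 2 (E X)) (hvol : ∀ X ∈ smallAt small D b, vol cint X ≠ 0)
    (hE : ∀ X φ, E (X.map τ.toEmbedding) φ = E X (P φ)) (hP1 : P 1 = 1)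
    (hpint : ∀ X h, pint cint (X.map τ.toEmbedding) h = pint cint X (P h))
    (hPc : P (coord μ - fun _ => c₀) = -(coord μ - fun _ => c₀)) :
    alpha2dAt cint coord c small E D b μ = 0 := by
  -- switch to the base point of the reflection
  let c' : ι → ℝ := Function.update c μ c₀
  have hcc : ∀ X ∈ smallAt small D b, alpha2d cint coord c E X μ = alpha2d cint coord c' E X μ :=
    fun X hX => alpha2d_baseIndep (hC2 X hX) (hvol X hX) c c' μ
  have hc'μ : c' μ = c₀ := by simp [c']
  have hS : alpha2dAt cint coord c small E D b μ = ∑ X ∈ smallAt small D b, alpha2d cint coord c' E X μ := by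
    simp only [alpha2dAt]; exact Finset.sum_congr rfl hcc
  -- the reflected sum is minus itself
  have hflip : ∑ X ∈ smallAt small D b, alpha2d cint coord c' E X μ =
      -∑ X ∈ smallAt small D b, alpha2d cint coord c' E X μ := by
    have hmem : ∀ X ∈ smallAt small D b, X.map τ.toEmbedding ∈ smallAt small D b := by
      intro X hX
      rw [mem_smallAt] at hX ⊢
      refine ⟨(hD X).2 hX.1, (hsm X).2 hX.2.1, ?_⟩
      rw [Finset.mem_map_equiv, ← hb, Equiv.symm_apply_apply]; simpa [hb] using hX.2.2
    calc ∑ X ∈ smallAt small D b, alpha2d cint coord c' E X μ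
        = ∑ X ∈ smallAt small D (τ b), alpha2d cint coord c' E X μ := by rw [hb]
      _ = ∑ X ∈ smallAt small D b, alpha2d cint coord c' E (X.map τ.toEmbedding) μ :=
          sum_smallAt_map τ hD hsm _ b
      _ = ∑ X ∈ smallAt small D b, -alpha2d cint coord c' E X μ := by
          refine Finset.sum_congr rfl fun X hX => ?_
          have hPc' : P (coord μ - fun _ => c' μ) = -(coord μ - fun _ => c' μ) := by rw [hc'μ]; exact hPc
          exact alpha2d_reflect τ P (hC2 X hX) (hE X) hP1 (hpint X) μ hPc'
      _ = -∑ X ∈ smallAt small D b, alpha2d cint coord c' E X μ := Finset.sum_neg_distrib _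
  rw [hS]; linarith

end Symmetry

/-! ## §6 LEMMA 13 (`study`): the mechanism of its proof -/

omit [Fintype Λ] in
/-- **LEMMA study, first bound — the mechanism** (L1834–1835: *"ε(E) ≤ Σ_{X⊃□}‖E(X)‖_k ≤ K_0‖E‖_{k,κ} as in
(summing)"*): with `Vol(X) ≥ 1` on the small polymers at `□`, a pointwise majorant `|E(X,0)| ≤ n(X)` (print: `‖E(X)‖_k`,
since `0 ∈ 𝓡_k`), `n(X) ≤ N·w(X)` (print: `N = ‖E‖_{k,κ}`, `w(X) = e^{−κd_M(X)}`) and (summing0) `Σ_{X⊃□}w(X) ≤ K_0`: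
`|ε(E)| ≤ N·K_0`. [cite: Dimock2013, §3.5 Lemma study with proof (arXiv:1108.1335v2 TeX L1824–1836) and §3.3 eq.
(summing) (TeX L1356–1361)] -/
theorem abs_epsAt_le [DecidableEq C] {D : Finset (Finset C)} {b : C} {n w : Finset C → ℝ} {N K0 : ℝ}
    (hvol : ∀ X ∈ smallAt small D b, 1 ≤ vol cint X) (hn : ∀ X ∈ smallAt small D b, |E X 0| ≤ n X)
    (hN : 0 ≤ N) (hw : ∀ X ∈ smallAt small D b, n X ≤ N * w X)
    (hK : ∑ X ∈ smallAt small D b, w X ≤ K0) :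
    |epsAt cint small E D b| ≤ N * K0 := by
  unfold epsAt
  rw [abs_neg]
  calc |∑ X ∈ smallAt small D b, alpha0 cint E X|
      ≤ ∑ X ∈ smallAt small D b, |alpha0 cint E X| := Finset.abs_sum_le_sum_abs _ _
    _ ≤ ∑ X ∈ smallAt small D b, N * w X := by
        refine Finset.sum_le_sum fun X hX => ?_
        have hv := hvol X hX
        have hv0 : 0 < vol cint X := by linarith
        rw [alpha0, abs_div, abs_of_pos hv0, div_le_iff₀ hv0]
        calc |E X 0| ≤ n X := hn X hX
          _ ≤ N * w X := hw X hX
          _ ≤ N * w X * vol cint X := by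
              have : 0 ≤ N * w X := (abs_nonneg _).trans ((hn X hX).trans (hw X hX))
              nlinarith
    _ = N * ∑ X ∈ smallAt small D b, w X := by rw [Finset.mul_sum]
    _ ≤ N * K0 := mul_le_mul_of_nonneg_left hK hN

/-- **LEMMA study, second bound — the mechanism** (L1836: *"The second bound uses (saint) and follows in the same way"*):
with (saint) `|E_2(X,0;1,1)| ≤ s·n(X)` (print: `s = 𝒪(1)λ_k^{1/2+6ε}`) as input, `|μ(E)| = 2|½μ(E)| ≤ s·N·K_0`.
[cite: Dimock2013, §3.5 Lemma study with proof and eq. (saint) (arXiv:1108.1335v2 TeX L1771–1773, L1824–1836)] -/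
theorem abs_twice_halfMuAt_le [DecidableEq C] {D : Finset (Finset C)} {b : C} {n w : Finset C → ℝ}
    {s N K0 : ℝ}
    (hvol : ∀ X ∈ smallAt small D b, 1 ≤ vol cint X) (hs : 0 ≤ s)
    (hsaint : ∀ X ∈ smallAt small D b, |D2 (E X) 1 1| ≤ s * n X)
    (hN : 0 ≤ N) (hw : ∀ X ∈ smallAt small D b, n X ≤ N * w X)
    (hw0 : ∀ X ∈ smallAt small D b, 0 ≤ w X) (hK : ∑ X ∈ smallAt small D b, w X ≤ K0) :
    |2 * halfMuAt cint small E D b| ≤ s * N * K0 := by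
  unfold halfMuAt
  rw [mul_neg, abs_neg, Finset.mul_sum]
  calc |∑ X ∈ smallAt small D b, 2 * alpha2 cint E X|
      ≤ ∑ X ∈ smallAt small D b, |2 * alpha2 cint E X| := Finset.abs_sum_le_sum_abs _ _
    _ ≤ ∑ X ∈ smallAt small D b, s * (N * w X) := by
        refine Finset.sum_le_sum fun X hX => ?_
        have hv := hvol X hX
        have hv0 : 0 < vol cint X := by linarith
        have e : 2 * alpha2 cint E X = D2 (E X) 1 1 / vol cint X := by
          simp only [alpha2]; field_simp
        rw [e, abs_div, abs_of_pos hv0, div_le_iff₀ hv0]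
        calc |D2 (E X) 1 1| ≤ s * n X := hsaint X hX
          _ ≤ s * (N * w X) := mul_le_mul_of_nonneg_left (hw X hX) hs
          _ ≤ s * (N * w X) * vol cint X := by
              have : 0 ≤ s * (N * w X) := mul_nonneg hs (mul_nonneg hN (hw0 X hX))
              nlinarith
    _ = s * N * ∑ X ∈ smallAt small D b, w X := by rw [Finset.mul_sum]; exact Finset.sum_congr rfl fun _ _ => by ring
    _ ≤ s * N * K0 := mul_le_mul_of_nonneg_left hK (mul_nonneg hs hN)

/-! ## §7 (v1.1) The bridge to the §4.7–4.8 assembly: (renorm2) as `SmallFieldStepAssembly.Extracted` -/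

/-- **(renorm2) packaged for the small-field step assembly.**  With `V = Vol(𝕋) = Σ_□∫_□1` and `‖φ‖² = Σ_□∫_□φ²`, the
polymer expansion `F = Σ_{X∈𝒟}E(X,·)` is EXTRACTED in the sense of `SmallFieldStepAssembly.Extracted` (the hypothesis
shape of the (renorm2) input at L2609–2630: *"F(φ) = −ε(F)Vol − ½μ(F)‖φ‖² + 𝓡F(φ)"*) with `ε = ε(E)` (`epsAt`, □-independent
by `hT0`), `μ = 2·(½μ(E))` (`halfMuAt`, by `hT2`), `𝓡F = Σ_{X∈𝒟}𝓡E(X,·)`, GIVEN the vanishing `Σ_{X⊃□}α_{2,μ} = 0` (`hR`);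
the norms `‖F‖_{k+1,κ} = nF ≥ 0` and `‖𝓡F‖_{k+1,κ} = nR` are parameters (their estimates are LEMMAS 12–13, not typed here).
[cite: Dimock2013, §3.5 eq. (renorm2) (arXiv:1108.1335v2 TeX L1802–1821) and §4.8 (TeX L2609–2630)] -/
def toExtracted [Fintype C] [DecidableEq C] [Fintype ι] (D : Finset (Finset C)) {eps hmu : ℝ}
    (hT0 : ∀ b, epsAt cint small E D b = eps)
    (hT2 : ∀ b, halfMuAt cint small E D b = hmu) (hR : ∀ b μ, alpha2dAt cint coord c small E D b μ = 0)
    (nF nR : ℝ) (hnF : 0 ≤ nF) :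
    SmallFieldStepAssembly.Extracted (Φ := Λ → ℝ) (∑ b, cint b 1) (fun φ => ∑ b, cint b (φ * φ)) where
  F := fun φ => ∑ X ∈ D, E X φ
  nF := nF
  eps := eps
  mu := 2 * hmu
  R := fun φ => ∑ X ∈ D, renorm cint coord c der small E X φ
  nR := nR
  nF_nonneg := hnF
  eq := fun φ => by rw [renorm2 (der := der) D hT0 hT2 hR φ]; ring

/-- the packaged functional is `Σ_{X∈𝒟}E(X,·)`. [cite: Dimock2013, §3.5 eq. (renorm2) (arXiv:1108.1335v2 TeX L1802–1807)] -/
@[simp] theorem toExtracted_F [Fintype C] [DecidableEq C] [Fintype ι] (D : Finset (Finset C)) {eps hmu : ℝ}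
    (hT0 : ∀ b, epsAt cint small E D b = eps)
    (hT2 : ∀ b, halfMuAt cint small E D b = hmu) (hR : ∀ b μ, alpha2dAt cint coord c small E D b μ = 0)
    (nF nR : ℝ) (hnF : 0 ≤ nF) (φ : Λ → ℝ) :
    (toExtracted (der := der) D hT0 hT2 hR nF nR hnF).F φ = ∑ X ∈ D, E X φ := rfl

/-- the packaged `𝓡F` is `Σ_{X∈𝒟}𝓡E(X,·)`. [cite: Dimock2013, §3.5 eq. (renorm2) (arXiv:1108.1335v2 TeX L1802–1807)] -/
@[simp] theorem toExtracted_R [Fintype C] [DecidableEq C] [Fintype ι] (D : Finset (Finset C)) {eps hmu : ℝ}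
    (hT0 : ∀ b, epsAt cint small E D b = eps)
    (hT2 : ∀ b, halfMuAt cint small E D b = hmu) (hR : ∀ b μ, alpha2dAt cint coord c small E D b μ = 0)
    (nF nR : ℝ) (hnF : 0 ≤ nF) (φ : Λ → ℝ) :
    (toExtracted (der := der) D hT0 hT2 hR nF nR hnF).R φ = ∑ X ∈ D, renorm cint coord c der small E X φ := rfl

/-- the packaged `ε(F)`, `μ(F)` are `ε(E)` and `2·(½μ(E))` read at any cube — the inputs `𝓛₁`, `𝓛₂` of the recursion
(recursive). [cite: Dimock2013, §3.5 eq. (renorm2) (arXiv:1108.1335v2 TeX L1811–1812) and §4.8 (TeX L2623–2630)] -/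
theorem toExtracted_eps_mu [Fintype C] [DecidableEq C] [Fintype ι] (D : Finset (Finset C)) {eps hmu : ℝ}
    (hT0 : ∀ b, epsAt cint small E D b = eps)
    (hT2 : ∀ b, halfMuAt cint small E D b = hmu) (hR : ∀ b μ, alpha2dAt cint coord c small E D b μ = 0)
    (nF nR : ℝ) (hnF : 0 ≤ nF) (b : C) :
    SmallFieldStepAssembly.L1E (toExtracted (der := der) D hT0 hT2 hR nF nR hnF) = epsAt cint small E D b ∧
      SmallFieldStepAssembly.L2E (toExtracted (der := der) D hT0 hT2 hR nF nR hnF) = 2 * halfMuAt cint small E D b := by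
  simp only [SmallFieldStepAssembly.L1E, SmallFieldStepAssembly.L2E, toExtracted, hT0 b, hT2 b, and_self]

end Lattice

end Literature.MathematicalPhysics.QuantumFieldTheory.Dimock2011to13.NormalizationExtraction

end
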